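import Summits.CriticalPhenomena.PercolationContinuityZ3.Theorems.PercNearOneGluingNoHeavyLowerTailCertRowsPat
import HarnessLib

/-!
# `NoHeavyLowerTail` (stmt-CriticalPhenomena-4575) — certificate rows: k-PETAL SUNFLOWER and GLADKOV–ZIMIN KERNEL groups as DATA

Support file (prover prim-ineq-prove-1, new-inequality factory; `--supports stmt-CriticalPhenomena-4575`).  Bookkeeping definitions only
(no soundness here, no named facts, no sorries): the row GROUPS of the quadratic certificate checker (`CertGeneral.checkQ`) for
* `SFKSpec` — a k-petal increasing sunflower (top test `φA`, a LIST of petal tests): `SFKSpec.valid` decides the side conditions of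
  `PatternSunflower.patternSunflower` (with a Boolean `allPairs` for pairwise disjointness), `SFKSpec.rows = sfkRows …` is the group
  `[⟨C₁, C₂++⋯++C_k, A, B⟩, ⟨C₂, C₃++⋯, [], []⟩, …]` whose summed inequality is `Σ_{i<j} c_i c_j ≤ μ(A)μ(B)` [Gladkov2024StrongFKG, Thm. 2.1];
* `GZSpec` — a Gladkov–Zimin kernel: a `52 × 52` integer array indexed by pattern INDICES (positions in `CertCells.consPatterns`), a multiplier,
  a weight; `GZSpec.valid` decides the kernel condition `K(a,d) + K(b,c) ≤ K(a,c) + K(b,d)` over the 306 strictly finer-than pairs; `GZSpec.rows`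
  encodes `Σ_{a,b} K(a,b) x_a x_b ≤ Σ_a K(a,a) x_a · μ[⊤]` entry by entry [GladkovZimin2024HK, Thm. 2.3].
The summed validity of these groups at the cell law (from `PatternSunflower.patternSunflower` / the measure form of Gladkov–Zimin's theorem) is
proved in separate files; the certificate wrapper `…CondCertCore` takes it as an explicit hypothesis, vacuous for certificates without such groups.
[cite: Gladkov2024StrongFKG, Thm. 2.1; GladkovZimin2024HK, Thm. 2.3]
-/

noncomputable section

namespace Summit.CriticalPhenomena.PercolationContinuityZ3.Theorems

open MeasureTheory Set Literature.Probability.Percolation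
open Literature.Probability.LatticeModels (prodBernoulli)
open scoped Classical BigOperators
open PatternCells CertCheck CertCells PatternSunflower

namespace CertCells

variable {n : ℕ}

/-! ## k-petal sunflower groups (data) -/

/-- Boolean "all unordered pairs of a list satisfy `R`". [folklore] -/
def allPairs {α : Type*} (R : α → α → Bool) : List α → Bool
  | [] => true
  | a :: t => t.all (R a) && allPairs R t

/-- `allPairs R l = true` gives `List.Pairwise`. [folklore] -/
theorem pairwise_of_allPairs {α : Type*} (R : α → α → Bool) :
    ∀ l : List α, allPairs R l = true → l.Pairwise fun a b => R a b = true
  | [], _ => List.Pairwise.nil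
  | a :: t, h => by
    simp only [allPairs, Bool.and_eq_true, List.all_eq_true] at h
    exact List.Pairwise.cons (fun b hb => h.1 b hb) (pairwise_of_allPairs R t h.2)

/-- The disjunction of a list of pattern tests. [folklore] -/
def anyTestL (φs : List (ℕ → Bool)) (m : ℕ) : Bool := φs.any fun φ => φ m

/-- The tail rows `⟨C_i, C_{i+1}++⋯++C_k, [], []⟩` of a k-petal sunflower group. [folklore] -/
def sfkTail : List (List ℕ) → List ℕ → ℕ → List Row
  | [], _, _ => []
  | C :: rest, mult, wt => ⟨C, rest.flatten, [], [], mult, wt⟩ :: sfkTail rest mult wt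

/-- A k-petal sunflower group as product rows sharing multiplier and weight: the head row carries `A·B`. [folklore] -/
def sfkRows (A B : List ℕ) : List (List ℕ) → List ℕ → ℕ → List Row
  | [], _, _ => []
  | C :: rest, mult, wt => ⟨C, rest.flatten, A, B, mult, wt⟩ :: sfkTail rest mult wt

/-- A k-petal (increasing) sunflower row group: top test `φA`, petal tests, multiplier, weight. [cite: Gladkov2024StrongFKG, Thm. 2.1] -/
structure SFKSpec where
  /-- top event test (`A`, increasing) -/
  φA : ℕ → Bool
  /-- the petal tests -/
  φCs : List (ℕ → Bool)
  /-- monomial multiplier -/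
  mult : List ℕ
  /-- weight -/
  wt : ℕ

/-- Side conditions (decidable): `φA` and all `φA ∨ φ` monotone, petals pairwise disjoint and disjoint from `φA`. [folklore] -/
def SFKSpec.valid (s : SFKSpec) : Bool :=
  MonoPat s.φA && (s.φCs.all fun φ => MonoPat fun m => s.φA m || φ m) && allPairs DisjPat s.φCs &&
    s.φCs.all fun φ => DisjPat s.φA φ

/-- The complement test `B = ¬(A ∨ ⋁ C_i)`. [folklore] -/
def SFKSpec.φB (s : SFKSpec) : ℕ → Bool := fun m => !(s.φA m || anyTestL s.φCs m)

/-- The row group. [folklore] -/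
def SFKSpec.rows (s : SFKSpec) : List Row := sfkRows (patCells s.φA) (patCells s.φB) (s.φCs.map patCells) s.mult s.wt

/-! ## Gladkov–Zimin kernel groups (data) -/

/-- Members of `consPatterns` are `< 1024`. [folklore] -/
theorem lt_of_mem_consPatterns {m : ℕ} (hm : m ∈ consPatterns) : m < 1024 := by
  rw [consPatterns_eq, List.mem_filter, List.mem_range] at hm
  exact hm.1

/-- Members of `consPatterns` are consistent. [folklore] -/
theorem cons_of_mem_consPatterns {m : ℕ} (hm : m ∈ consPatterns) : Cons5 m = true := by
  rw [consPatterns_eq, List.mem_filter] at hm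
  simpa using hm.2

/-- `consPatterns` has no duplicates. [folklore] -/
theorem nodup_consPatterns : consPatterns.Nodup := by
  rw [consPatterns_eq]
  exact List.nodup_range.filter _

/-- Entry `(i, j)` of an integer table (default `0`). [folklore] -/
def kget (K : Array (Array ℤ)) (i j : ℕ) : ℤ := (K.getD i #[]).getD j 0

/-- Index of a pattern number in `consPatterns` (`52` if absent). [folklore] -/
def pidx (m : ℕ) : ℕ := consPatterns.idxOf m

/-- A Gladkov–Zimin kernel row group: a `52 × 52` integer kernel on pattern indices, a monomial multiplier, a weight.
[cite: GladkovZimin2024HK, Thm. 2.3] -/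
structure GZSpec where
  /-- the kernel, indexed by pattern indices (positions in `consPatterns`) -/
  ker : Array (Array ℤ)
  /-- monomial multiplier -/
  mult : List ℕ
  /-- weight -/
  wt : ℕ

/-- The kernel as a function of pattern NUMBERS. [folklore] -/
def GZSpec.A (s : GZSpec) (a b : ℕ) : ℤ := kget s.ker (pidx a) (pidx b)

/-- Strictly comparable ordered pairs of consistent patterns. [folklore] -/
def strictPairs : List (ℕ × ℕ) :=
  (consPatterns.flatMap fun a => consPatterns.map fun b => (a, b)).filter fun p => BitSub p.1 p.2 && decide (p.1 ≠ p.2)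

/-- Membership in `strictPairs`. [folklore] -/
theorem mem_strictPairs {a b : ℕ} (ha : a ∈ consPatterns) (hb : b ∈ consPatterns) (hab : BitSub a b = true)
    (hne : a ≠ b) : (a, b) ∈ strictPairs := by
  unfold strictPairs
  rw [List.mem_filter]
  refine ⟨?_, by simp [hab, hne]⟩
  rw [List.mem_flatMap]
  exact ⟨a, ha, List.mem_map.2 ⟨b, hb, rfl⟩⟩

/-- Validity of a kernel (decidable): the Gladkov–Zimin condition on strictly comparable pairs. [folklore] -/
def GZSpec.valid (s : GZSpec) : Bool :=
  strictPairs.all fun p => strictPairs.all fun q =>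
    decide (s.A p.1 q.2 + s.A p.2 q.1 ≤ s.A p.1 q.1 + s.A p.2 q.2)

/-! ## The rows of a kernel group -/

/-- The rows of the entry `(a, b)`: off the diagonal `K(a,b) x_a x_b` on the side given by its sign; on the diagonal additionally
`K(a,a) x_a · μ[⊤]` on the opposite side. [folklore] -/
def GZSpec.entryRows (s : GZSpec) (a b : ℕ) : List Row :=
  let k := s.A a b
  (if 0 < k then [⟨[a], [b], [], [], s.mult, s.wt * k.toNat⟩]
    else if k < 0 then [⟨[], [], [a], [b], s.mult, s.wt * (-k).toNat⟩] else []) ++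
  (if a = b then
    (if 0 < k then [⟨[], [], [a], patCells fun _ => true, s.mult, s.wt * k.toNat⟩]
      else if k < 0 then [⟨[a], patCells fun _ => true, [], [], s.mult, s.wt * (-k).toNat⟩] else [])
   else [])

/-- All rows of a kernel group. [folklore] -/
def GZSpec.rows (s : GZSpec) : List Row :=
  consPatterns.flatMap fun a => consPatterns.flatMap fun b => s.entryRows a b

/-- `linEval` of a singleton. [folklore] -/
theorem linEval_single (x : ℕ → ℝ) (a : ℕ) : linEval x [a] = x a := by simp [linEval]

/-- `linEval` of the empty list. [folklore] -/
theorem linEval_empty (x : ℕ → ℝ) : linEval x [] = 0 := by simp [linEval]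

/-- The signed balance of the rows of one entry: `(Σ e3e4-side) − (Σ e1e2-side) = wt·m·([a=b] K(a,a) x_a · L⊤ − K(a,b) x_a x_b)`
where `L⊤ = linEval x (patCells ⊤)`. [folklore] -/
theorem GZSpec.entryRows_balance (s : GZSpec) (x : ℕ → ℝ) (a b : ℕ) :
    ((s.entryRows a b).map fun r => (r.wt : ℝ) * evalM x r.mult * (linEval x r.e3 * linEval x r.e4)).sum -
      ((s.entryRows a b).map fun r => (r.wt : ℝ) * evalM x r.mult * (linEval x r.e1 * linEval x r.e2)).sum =
      (s.wt : ℝ) * evalM x s.mult *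
        ((if a = b then (s.A a b : ℝ) * (x a * linEval x (patCells fun _ => true)) else 0) - (s.A a b : ℝ) * (x a * x b)) := by
  have hpos : ∀ k : ℤ, 0 < k → ((k.toNat : ℕ) : ℝ) = (k : ℝ) := fun k hk => by
    have : ((k.toNat : ℤ)) = k := Int.toNat_of_nonneg hk.le
    exact_mod_cast this
  have hneg : ∀ k : ℤ, k < 0 → (((-k).toNat : ℕ) : ℝ) = -(k : ℝ) := fun k hk => by
    have : (((-k).toNat : ℤ)) = -k := Int.toNat_of_nonneg (by linarith)
    exact_mod_cast this
  dsimp only [GZSpec.entryRows]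
  by_cases hab : a = b
  · subst hab
    simp only [if_true]
    rcases lt_trichotomy 0 (s.A a a) with hk | hk | hk
    · simp only [if_pos hk, List.singleton_append, List.map_cons, List.map_nil, List.sum_cons, List.sum_nil,
        linEval_single, linEval_empty, Nat.cast_mul, hpos _ hk]
      ring
    · simp [← hk]
    · have hk' : ¬ 0 < s.A a a := not_lt.2 hk.le
      simp only [if_neg hk', if_pos hk, List.singleton_append, List.map_cons, List.map_nil, List.sum_cons, List.sum_nil,
        linEval_single, linEval_empty, Nat.cast_mul, hneg _ hk]
      ring
  · simp only [hab, if_false, List.append_nil]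
    rcases lt_trichotomy 0 (s.A a b) with hk | hk | hk
    · simp only [if_pos hk, List.map_cons, List.map_nil, List.sum_cons, List.sum_nil, linEval_single, linEval_empty,
        Nat.cast_mul, hpos _ hk]
      ring
    · simp [← hk]
    · have hk' : ¬ 0 < s.A a b := not_lt.2 hk.le
      simp only [if_neg hk', if_pos hk, List.map_cons, List.map_nil, List.sum_cons, List.sum_nil, linEval_single,
        linEval_empty, Nat.cast_mul, hneg _ hk]
      ring

/-- Balance of a `flatMap`: sums of differences. [folklore] -/
theorem sum_map_flatMap_sub {α : Type*} (l : List α) (F : α → List Row) (g h : Row → ℝ) :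
    ((l.flatMap F).map g).sum - ((l.flatMap F).map h).sum = (l.map fun a => ((F a).map g).sum - ((F a).map h).sum).sum := by
  induction l with
  | nil => simp
  | cons a t ih =>
    simp only [List.flatMap_cons, List.map_append, List.sum_append, List.map_cons, List.sum_cons]
    rw [← ih]
    ring

/-- `Σ (f − g) = Σ f − Σ g` for list sums. [folklore] -/
theorem sum_map_sub' {α : Type*} (l : List α) (f g : α → ℝ) :
    (l.map fun a => f a - g a).sum = (l.map f).sum - (l.map g).sum := by
  induction l with
  | nil => simp
  | cons a t ih =>
    simp only [List.map_cons, List.sum_cons]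
    rw [ih]
    ring

/-- `Σ c·f = c·Σ f` for list sums. [folklore] -/
theorem sum_map_const_mul' {α : Type*} (l : List α) (c : ℝ) (f : α → ℝ) :
    (l.map fun a => c * f a).sum = c * (l.map f).sum := by
  induction l with
  | nil => simp
  | cons a t ih =>
    simp only [List.map_cons, List.sum_cons]
    rw [ih]
    ring

/-- The inner diagonal sum: `Σ_{b} [a=b] f b = f a` for `a ∈ consPatterns`. [folklore] -/
theorem sum_diag_ite (f : ℕ → ℝ) {a : ℕ} (ha : a ∈ consPatterns) :
    (consPatterns.map fun b => if a = b then f b else 0).sum = f a := by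
  rw [← List.sum_toFinset _ nodup_consPatterns, Finset.sum_ite_eq]
  simp [List.mem_toFinset, ha]


/-! ## Summed validity of row groups (proved per family in `…CertRowsSFK` / `…CertRowsGZ`; consumed as hypotheses by `…CondCertCore`) -/

/-- `GroupHolds rows`: the rows hold IN SUM at the cell law of every weighted graph and every placement of the five terminals
(a predicate with parameters, not a statement). [folklore] -/
def GroupHolds (rows : List Row) : Prop :=
  ∀ (n : ℕ) (w : Sym2 (Fin n) → unitInterval) (v : Fin 5 → Fin n),
    (rows.map fun r => (r.wt : ℝ) * evalM (fun m => (prodBernoulli w).real (Cell v m)) r.mult *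
        (linEval (fun m => (prodBernoulli w).real (Cell v m)) r.e1 * linEval (fun m => (prodBernoulli w).real (Cell v m)) r.e2)).sum ≤
      (rows.map fun r => (r.wt : ℝ) * evalM (fun m => (prodBernoulli w).real (Cell v m)) r.mult *
        (linEval (fun m => (prodBernoulli w).real (Cell v m)) r.e3 * linEval (fun m => (prodBernoulli w).real (Cell v m)) r.e4)).sum

/-- A `flatMap` of groups that all hold in sum holds in sum. [folklore] -/
theorem groupHolds_flatMap {α : Type*} (l : List α) (rows : α → List Row) (h : ∀ a ∈ l, GroupHolds (rows a)) :
    GroupHolds (l.flatMap rows) := by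
  intro n w v
  induction l with
  | nil => simp
  | cons a t ih =>
    rw [List.flatMap_cons, List.map_append, List.map_append, List.sum_append, List.sum_append]
    exact add_le_add (h a (by simp) n w v) (ih fun b hb => h b (List.mem_cons_of_mem _ hb))

end CertCells

end Summit.CriticalPhenomena.PercolationContinuityZ3.Theorems

end
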